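import Mathlib
import HarnessLib
import Summits.Ventures.LatticeQCDFlow.Scaling.Bhattacharyya
import Summits.Ventures.LatticeQCDFlow.Scaling.StochasticBudgets

/-!
# LatticeQCDFlow / Scaling — the LAYER-COUNT LAW: `Π_k ESS(p_{k+1}, p_k) ≤ exp(−H²/n)` (v2.5)

HONEST FRAMING: exact (Metropolis-corrected) sampling algorithms for lattice gauge theory; figures
of merit are autocorrelation/cost numbers at stated couplings and volumes; no continuum-physics
claim.

Venture `LatticeQCDFlow` (cell pub-lqcd), topic `Scaling`, FANOUT row 29 (theory2) — OUR WORK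
(THEORY-2.md v2.5 §3.5 (vi) / §4 row C3).  Finite-state, elementary; nothing is cited as a fact.

THE STATEMENT.  For ANY chain of positive probability vectors `p_0, …, p_n` on a finite set (no
Gibbs / exponential-family structure assumed), the perfect-relaxation product obeys

  `Π_{k<n} ESS(p_{k+1}, p_k) ≤ exp(−‖√p_n − √p_0‖² / n)`     (`prod_essFrac_le_exp_neg_hellinger`)

where `‖√p − √q‖² = Σ_x (√p_x − √q_x)² = 2(1 − BC(p, q))` is the squared HELLINGER LENGTH between
the END POINTS (`norm_sqrtVec_sub_sq`).  Read as a LAYER-COUNT LAW: to keep the product `≥ δ` one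
needs `n ≥ ‖√p_n − √p_0‖² / log(1/δ)` protocol steps, whatever the intermediate laws — the
discrete, assumption-free form of the thermodynamic-length bound ("`ÊSS ≈ exp(−ℒ²/n)`") of
THEORY-2.md §4 row C3 / tree `ess_perfect_relaxation`.  Combined with (C3″)/(C3‴)/(C3-IMH)
(perfect relaxation dominates monotone layers) it bounds every monotone annealing sampler, and
with the volume law (item 27, `m` independent sites) the exponent becomes `m·‖√p_n − √p_0‖²/n`:
the number of layers must grow LINEARLY IN THE VOLUME (file `PerfectRelaxationVolumeLength`).

PROOF.  (1) `ESS(p,q) ≤ BC(p,q)²` (`essFrac_le_bhatt_sq`: two Cauchy–Schwarz inequalities,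
`(Σp)² ≤ Σ p√(p/q) · Σ √(pq)` and `(Σ p√(p/q))² ≤ Σ p²/q · Σ p`);  (2) the square-root embedding
`p ↦ √p ∈ ℝ^X` (`sqrtVec`) has `⟪√p, √q⟫ = BC`, `‖√p‖ = 1`, so `BC = 1 − ‖√p − √q‖²/2 ≤
exp(−‖√p − √q‖²/2)` and `BC² ≤ exp(−‖√p − √q‖²)`;  (3) along the chain, `exp` turns the product
into `exp(−Σ_k d_k²)`, Cauchy–Schwarz gives `Σ_k d_k² ≥ (Σ_k d_k)²/n`, and the triangle
inequality in `ℝ^X` gives `Σ_k d_k ≥ ‖√p_n − √p_0‖` (`dist_chain_le`).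

Contents: `essFrac_le_bhatt_sq`, `sqrtVec` (+ `inner_sqrtVec`, `inner_sqrtVec_eq_bhatt`,
`norm_sqrtVec`, `norm_sqrtVec_sub_sq`), `bhatt_sq_le_exp_neg`, `essFrac_le_exp_neg_hellinger`,
`dist_chain_le`, `prod_essFrac_le_exp_neg_hellinger`, `ess_perfect_relaxation_le_exp_neg_hellinger`.
-/

noncomputable section

namespace Summit.Ventures.LatticeQCDFlow.Theory2

open Finset Summit.Ventures.LatticeQCDFlow.Exactness
open scoped RealInnerProductSpace

variable {X : Type*} [Fintype X]

/-! ## `ESS ≤ BC²` -/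

/-- **`ESS(p, q) ≤ BC(p, q)²`** for a probability vector `p ≥ 0` and a positive `q`: by
Cauchy–Schwarz twice, `1 = (Σp)² ≤ Σ p√(p/q) · Σ√(pq)` and `(Σ p√(p/q))² ≤ Σ p²/q · Σ p`, so
`1 ≤ BC² · Σ p²/q = BC²/ESS`. [folklore] -/
theorem essFrac_le_bhatt_sq {p q : X → ℝ} (hp : ∀ x, 0 ≤ p x) (hq : ∀ x, 0 < q x)
    (hp1 : ∑ x, p x = 1) : essFrac p q ≤ bhatt p q ^ 2 := by
  obtain ⟨x₀, hx₀⟩ : ∃ x, p x ≠ 0 := by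
    by_contra h
    push Not at h
    simp [h] at hp1
  have hpx₀ : 0 < p x₀ := lt_of_le_of_ne (hp x₀) (Ne.symm hx₀)
  have hM : 0 < ∑ x, p x * weight p q x :=
    sum_pos' (fun x _ => mul_nonneg (hp x) (div_nonneg (hp x) (hq x).le))
      ⟨x₀, mem_univ _, mul_pos hpx₀ (div_pos hpx₀ (hq x₀))⟩
  -- first Cauchy–Schwarz: `(Σ p)² ≤ Σ p√(p/q) · Σ √(pq)`
  have h1 : (∑ x, p x) ^ 2 ≤ (∑ x, p x * Real.sqrt (p x / q x)) * ∑ x, Real.sqrt (p x * q x) := by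
    refine sum_sq_le_sum_mul_sum_of_sq_le_mul univ
      (fun x _ => mul_nonneg (hp x) (Real.sqrt_nonneg _)) (fun x _ => Real.sqrt_nonneg _)
      fun x _ => le_of_eq ?_
    have hx : p x / q x * (p x * q x) = p x ^ 2 := by
      rw [div_mul_eq_mul_div, show p x * (p x * q x) = p x ^ 2 * q x by ring,
        mul_div_cancel_right₀ _ (hq x).ne']
    rw [mul_assoc, ← Real.sqrt_mul (div_nonneg (hp x) (hq x).le), hx, Real.sqrt_sq (hp x), sq]
  -- second Cauchy–Schwarz: `(Σ p√(p/q))² ≤ Σ p²/q · Σ p`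
  have h2 : (∑ x, p x * Real.sqrt (p x / q x)) ^ 2 ≤ (∑ x, p x * weight p q x) * ∑ x, p x := by
    refine sum_sq_le_sum_mul_sum_of_sq_le_mul univ
      (fun x _ => mul_nonneg (hp x) (div_nonneg (hp x) (hq x).le)) (fun x _ => hp x)
      fun x _ => le_of_eq ?_
    rw [mul_pow, Real.sq_sqrt (div_nonneg (hp x) (hq x).le), weight]
    ring
  rw [hp1, one_pow] at h1
  rw [hp1, mul_one] at h2
  rw [essFrac_eq_inv hq hp1, inv_eq_one_div, div_le_iff₀ hM]
  have h3 : 1 ≤ ((∑ x, p x * Real.sqrt (p x / q x)) * ∑ x, Real.sqrt (p x * q x)) ^ 2 := by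
    simpa using pow_le_pow_left₀ zero_le_one h1 2
  have h4 : (∑ x, p x * Real.sqrt (p x / q x)) ^ 2 * (∑ x, Real.sqrt (p x * q x)) ^ 2 ≤
      (∑ x, p x * weight p q x) * (∑ x, Real.sqrt (p x * q x)) ^ 2 :=
    mul_le_mul_of_nonneg_right h2 (sq_nonneg _)
  rw [mul_pow] at h3
  rw [bhatt]
  linarith

/-! ## The square-root (Hellinger) embedding into `ℝ^X` -/

/-- The square-root embedding `p ↦ (√p_x)_x ∈ ℝ^X` (Euclidean space). [folklore] -/
def sqrtVec (p : X → ℝ) : EuclideanSpace ℝ X :=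
  (WithLp.equiv 2 (X → ℝ)).symm fun x => Real.sqrt (p x)

/-- `⟪√p, √q⟫ = Σ √p √q`. [folklore] -/
theorem inner_sqrtVec (p q : X → ℝ) :
    ⟪sqrtVec p, sqrtVec q⟫ = ∑ x, Real.sqrt (p x) * Real.sqrt (q x) := by
  simp [sqrtVec, PiLp.inner_apply, mul_comm]

/-- `⟪√p, √q⟫ = BC(p, q)` for `p ≥ 0`. [folklore] -/
theorem inner_sqrtVec_eq_bhatt {p : X → ℝ} (hp : ∀ x, 0 ≤ p x) (q : X → ℝ) :
    ⟪sqrtVec p, sqrtVec q⟫ = bhatt p q := by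
  rw [inner_sqrtVec, bhatt]
  exact sum_congr rfl fun x _ => (Real.sqrt_mul (hp x) (q x)).symm

/-- `‖√p‖ = 1` for a probability vector. [folklore] -/
theorem norm_sqrtVec {p : X → ℝ} (hp : ∀ x, 0 ≤ p x) (hp1 : ∑ x, p x = 1) : ‖sqrtVec p‖ = 1 := by
  rw [EuclideanSpace.norm_eq]
  simp [sqrtVec, Real.norm_eq_abs, sq_abs, Real.sq_sqrt (hp _), hp1]

/-- The squared HELLINGER LENGTH: `‖√p − √q‖² = 2 − 2·BC(p, q)`. [folklore] -/
theorem norm_sqrtVec_sub_sq {p q : X → ℝ} (hp : ∀ x, 0 ≤ p x) (hq : ∀ x, 0 ≤ q x)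
    (hp1 : ∑ x, p x = 1) (hq1 : ∑ x, q x = 1) :
    ‖sqrtVec p - sqrtVec q‖ ^ 2 = 2 - 2 * bhatt p q := by
  rw [norm_sub_sq_real, norm_sqrtVec hp hp1, norm_sqrtVec hq hq1, inner_sqrtVec_eq_bhatt hp]
  ring

/-- `BC(p,q)² ≤ exp(−‖√p − √q‖²)`: `BC = 1 − ‖√p − √q‖²/2 ≤ exp(−‖√p − √q‖²/2)` and `BC ≥ 0`.
[folklore] -/
theorem bhatt_sq_le_exp_neg {p q : X → ℝ} (hp : ∀ x, 0 ≤ p x) (hq : ∀ x, 0 ≤ q x)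
    (hp1 : ∑ x, p x = 1) (hq1 : ∑ x, q x = 1) :
    bhatt p q ^ 2 ≤ Real.exp (-‖sqrtVec p - sqrtVec q‖ ^ 2) := by
  have hd := norm_sqrtVec_sub_sq hp hq hp1 hq1
  have h1 : bhatt p q ≤ Real.exp (-(‖sqrtVec p - sqrtVec q‖ ^ 2 / 2)) := by
    have := Real.add_one_le_exp (-(‖sqrtVec p - sqrtVec q‖ ^ 2 / 2))
    linarith
  calc bhatt p q ^ 2 ≤ Real.exp (-(‖sqrtVec p - sqrtVec q‖ ^ 2 / 2)) ^ 2 :=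
        pow_le_pow_left₀ (bhatt_nonneg p q) h1 2
    _ = Real.exp (-‖sqrtVec p - sqrtVec q‖ ^ 2) := by
        rw [← Real.exp_nat_mul]
        congr 1
        push_cast
        ring

/-- **`ESS(p, q) ≤ exp(−‖√p − √q‖²)`** for probability vectors `p ≥ 0`, `q > 0`. [folklore] -/
theorem essFrac_le_exp_neg_hellinger {p q : X → ℝ} (hp : ∀ x, 0 ≤ p x) (hq : ∀ x, 0 < q x)
    (hp1 : ∑ x, p x = 1) (hq1 : ∑ x, q x = 1) :
    essFrac p q ≤ Real.exp (-‖sqrtVec p - sqrtVec q‖ ^ 2) :=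
  (essFrac_le_bhatt_sq hp hq hp1).trans (bhatt_sq_le_exp_neg hp (fun x => (hq x).le) hp1 hq1)

/-! ## Chains: the layer-count law -/

/-- The triangle inequality along a chain `v_0, …, v_n`. [folklore] -/
theorem dist_chain_le {E : Type*} [PseudoMetricSpace E] :
    ∀ (n : ℕ) (v : Fin (n + 1) → E),
      dist (v (Fin.last n)) (v 0) ≤ ∑ k : Fin n, dist (v k.succ) (v k.castSucc)
  | 0, v => by simp
  | n + 1, v => by
    have ih := dist_chain_le n fun i => v i.castSucc
    rw [Fin.sum_univ_castSucc, Fin.succ_last]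
    calc dist (v (Fin.last (n + 1))) (v 0)
        ≤ dist (v (Fin.last (n + 1))) (v (Fin.last n).castSucc) +
            dist (v (Fin.last n).castSucc) (v 0) := dist_triangle _ _ _
      _ ≤ dist (v (Fin.last (n + 1))) (v (Fin.last n).castSucc) +
            ∑ k : Fin n, dist (v k.castSucc.succ) (v k.castSucc.castSucc) := by
          have h0 : ((0 : Fin (n + 1)).castSucc : Fin (n + 2)) = 0 := Fin.ext (by simp)
          rw [h0] at ih
          gcongr
          exact ih.trans (le_of_eq (sum_congr rfl fun k _ => rfl))
      _ = (∑ k : Fin n, dist (v k.castSucc.succ) (v k.castSucc.castSucc)) +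
            dist (v (Fin.last (n + 1))) (v (Fin.last n).castSucc) := add_comm _ _

/-- **THE LAYER-COUNT LAW (proved).**  For ANY chain of positive probability vectors
`p_0, …, p_n` (`n ≥ 1`): `Π_{k<n} ESS(p_{k+1}, p_k) ≤ exp(−‖√p_n − √p_0‖² / n)`.  So a
perfect-relaxation product `≥ δ` needs `n ≥ ‖√p_n − √p_0‖² / log(1/δ)` steps — the Hellinger length
of the END POINTS over the number of layers, whatever the intermediate laws. [folklore] -/
theorem prod_essFrac_le_exp_neg_hellinger {n : ℕ} (hn : 0 < n) (p : Fin (n + 1) → X → ℝ)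
    (hp : ∀ k x, 0 < p k x) (hp1 : ∀ k, ∑ x, p k x = 1) :
    ∏ k : Fin n, essFrac (p k.succ) (p k.castSucc) ≤
      Real.exp (-(‖sqrtVec (p (Fin.last n)) - sqrtVec (p 0)‖ ^ 2 / n)) := by
  have h1 : ∏ k : Fin n, essFrac (p k.succ) (p k.castSucc) ≤
      ∏ k : Fin n, Real.exp (-‖sqrtVec (p k.succ) - sqrtVec (p k.castSucc)‖ ^ 2) :=
    prod_le_prod (fun k _ => essFrac_nonneg fun x => (hp _ x).le) fun k _ =>
      essFrac_le_exp_neg_hellinger (fun x => (hp _ x).le) (hp _) (hp1 _) (hp1 _)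
  refine h1.trans ?_
  rw [← Real.exp_sum, Real.exp_le_exp, sum_neg_distrib, neg_le_neg_iff]
  have hcs : (∑ k : Fin n, ‖sqrtVec (p k.succ) - sqrtVec (p k.castSucc)‖) ^ 2 ≤
      (#(univ : Finset (Fin n)) : ℝ) *
        ∑ k : Fin n, ‖sqrtVec (p k.succ) - sqrtVec (p k.castSucc)‖ ^ 2 :=
    sq_sum_le_card_mul_sum_sq
  rw [card_univ, Fintype.card_fin] at hcs
  have htri : ‖sqrtVec (p (Fin.last n)) - sqrtVec (p 0)‖ ≤
      ∑ k : Fin n, ‖sqrtVec (p k.succ) - sqrtVec (p k.castSucc)‖ := by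
    have := dist_chain_le n fun k => sqrtVec (p k)
    simpa only [dist_eq_norm] using this
  have hn' : (0 : ℝ) < n := by exact_mod_cast hn
  rw [div_le_iff₀ hn']
  calc ‖sqrtVec (p (Fin.last n)) - sqrtVec (p 0)‖ ^ 2
      ≤ (∑ k : Fin n, ‖sqrtVec (p k.succ) - sqrtVec (p k.castSucc)‖) ^ 2 :=
        pow_le_pow_left₀ (norm_nonneg _) htri 2
    _ ≤ (n : ℝ) * ∑ k : Fin n, ‖sqrtVec (p k.succ) - sqrtVec (p k.castSucc)‖ ^ 2 := hcs
    _ = (∑ k : Fin n, ‖sqrtVec (p k.succ) - sqrtVec (p k.castSucc)‖ ^ 2) * n := mul_comm _ _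

/-- **Corollary: perfectly relaxing NE-MCMC / SNF along any protocol `S_0, …, S_n` has
`ÊSS ≤ exp(−‖√p_n − √p_0‖²/n)`** (tree `ess_perfect_relaxation`): even with perfect relaxation the
number of layers must be at least the squared Hellinger length of the end points over
`log(1/ÊSS)`. [folklore] -/
theorem ess_perfect_relaxation_le_exp_neg_hellinger [Nonempty X] [DecidableEq X] {n : ℕ}
    (hn : 0 < n) (S : Fin (n + 1) → X → ℝ) :
    essFrac (revPathLaw S fun k _ y => gibbsLaw (S k.succ) y)
        (pathLaw (gibbsLaw (S 0)) fun k _ y => gibbsLaw (S k.succ) y) ≤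
      Real.exp (-(‖sqrtVec (gibbsLaw (S (Fin.last n))) - sqrtVec (gibbsLaw (S 0))‖ ^ 2 / n)) := by
  rw [ess_perfect_relaxation S]
  exact prod_essFrac_le_exp_neg_hellinger hn (fun k => gibbsLaw (S k)) (fun _ x => gibbsLaw_pos _ x)
    fun _ => sum_gibbsLaw _

end Summit.Ventures.LatticeQCDFlow.Theory2

end
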